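import Literature.IUT.HodgeTheaters.PMBaseProp65Proofs

/-!
# Proofs over [IUTchI] Prop 6.6 (ii): rigidity of isomorphisms of `𝒟-Θ^{ell}`-bridges

Mochizuki, *Inter-universal Teichmüller theory I*, §6, Proposition 6.6 (ii) p. 165, kurims manuscript
(May 2020): "this set of isomorphisms maps bijectively, by considering the induced bijections, to the set
of isomorphisms of `𝔽_l^±`-torsors between the index sets of the capsules involved". PROOF-ONLY companion
(theorems, no definitions) to abc-iut-L5-t4's `PMBaseBridgeProps.lean`, by the L5 discharge seat
abc-iut-L5-t13.

PROVED here: the INJECTIVITY half — an isomorphism of `𝒟-Θ^{ell}`-bridges is determined by its index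
bijection (`DThetaEllBridge.Iso.eq_of_indexEquiv_eq`), for every base kit with at least one valuation
(`Nonempty K.V`; for `𝕍 = ∅` the compatibility conditions of Def 6.4 (ii) are empty and the statement
fails, so the hypothesis is necessary — in IUT `𝕍 ≅ 𝕍_mod ≠ ∅`). Mechanism: reading the compatibility
square of Def 6.4 (ii) on `±`-label classes (`labOfHom`) shows that two isomorphisms with the same index
bijection differ, at every `(t, v)`, by the SAME element `gLabMap(ψ⁻¹ψ')` conjugated by `†ζ^{Θell}_{v_t}`;
that element is then either trivial (and the isomorphisms coincide) or a reflection about every label at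
once, which forces `2 = 0` in `𝔽_l` and contradicts the existence of negative automorphisms.
The SURJECTIVITY half needs, for negative elements of `𝔽_l^{⋊±}`, the `[−1]`-compatibility of
`φ^{Θell}_{•,v}` (Example 6.3 (ii)), which the interface does not carry; it is not asserted here.
Record only; [claim: Mochizuki2012, status: disputed]; nothing here takes a side on any disputed step.
-/

namespace Literature.IUT.HodgeTheaters

open CategoryTheory

universe u

namespace PMBaseKit

variable {l : ℕ} {K : PMBaseKit.{u} l}

/-! ### Two more facts on signs -/

/-- Conjugating `z ↦ −z` on `LabCusp^±(†𝒟_v)` by the bijection induced by an isomorphism `†𝒟_v ⥲ ‡𝒟_v`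
gives `z ↦ −z` on `LabCusp^±(‡𝒟_v)`. [claim: Mochizuki2012, status: disputed] -/
theorem labMap_conj_labNeg {v : K.V} {X Y : K.Amb v} (hX : K.IsLocal v X) (hY : K.IsLocal v Y) (φ : X ≅ Y) :
    (K.labMap v φ).symm.trans ((labNeg hX).trans (K.labMap v φ)) = labNeg hY := by
  obtain ⟨α₀, hα₀⟩ := K.exists_negative v X hX
  obtain ⟨α₀, rfl⟩ : ∃ a : X ≅ X, a = α₀ := ⟨α₀, rfl⟩
  have hneg : K.labMap v α₀ = labNeg hX := (labMap_ne_refl_iff hX α₀).mp hα₀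
  have h : (K.labMap v φ).symm.trans ((labNeg hX).trans (K.labMap v φ)) = K.labMap v (φ.symm ≪≫ α₀ ≪≫ φ) := by
    rw [K.labMap_trans, K.labMap_trans, labMap_symm, hneg]
  rw [h, ← labMap_ne_refl_iff hY]
  intro habs
  rw [labMap_conj_eq_refl_iff] at habs
  exact hα₀ habs

/-- With a valuation present, `2 ≠ 0` in `𝔽_l` (else `z ↦ −z` would be trivial on `±`-label classes,
contradicting the existence of negative automorphisms, [IUTchI] Def 6.1 (iii)).
[claim: Mochizuki2012, status: disputed] -/
theorem two_ne_zero_of_isLocal {v : K.V} {X : K.Amb v} (hX : K.IsLocal v X) : (2 : ZMod l) ≠ 0 := by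
  intro h2
  apply labNeg_ne_refl hX
  have hneg : ∀ z : ZMod l, -z = z := fun z => by
    have : z + z = 0 := by rw [← two_mul, h2, zero_mul]
    exact (neg_eq_of_add_eq_zero_left this)
  ext x
  simp [labNeg, Units.smul_def, hneg]

namespace DThetaEllBridge

/-! ### Reading the compatibility square of an isomorphism on `±`-label classes -/

/-- **The key equation.** For an isomorphism of `𝒟-Θ^{ell}`-bridges with capsule constituent through
`φ_t` and global constituent through `ψ`, at every `(t, v)`:
`†ζ^{Θell}_{v_t} ≫ LabCusp^±(ψ) = LabCusp^±(φ_{t,v}) ≫ ‡ζ^{Θell}_{v_{κ t}}` — obtained by evaluating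
`labOfHom` on both sides of the compatibility square ([IUTchI] Def 6.4 (ii) p. 163; Prop 6.5 (i), (iv)).
[claim: Mochizuki2012, status: disputed] -/
theorem Iso.zeta_trans_gLabMap {B₁ B₂ : K.DThetaEllBridge} (g : Iso B₁ B₂) (t : B₁.T) (v : K.V)
    {φ : (B₁.capsule t).Iso (B₂.capsule (g.indexEquiv t))} (hφ : g.capsPoly t = DStrip.plusFullPolyIso φ)
    {ψ : B₁.glob ≅ B₂.glob} (hψ : ψ ∈ g.globPoly)
    {ζ₁ : K.LabCuspPM v ((B₁.capsule t).obj v) ≃ K.GLab B₁.glob} (hζ₁ : B₁.ZetaSpec t v ζ₁)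
    {ζ₂ : K.LabCuspPM v ((B₂.capsule (g.indexEquiv t)).obj v) ≃ K.GLab B₂.glob}
    (hζ₂ : B₂.ZetaSpec (g.indexEquiv t) v ζ₂) :
    ζ₁.trans (K.gLabMap ψ) = (K.labMap v (φ v)).trans ζ₂ := by
  obtain ⟨f, hf⟩ := B₁.poly_nonempty t v
  have hmem : f ≫ (K.atV v).map ψ.hom ∈ {h | ∃ p ∈ g.capsPoly t, ∃ g₂ ∈ B₂.poly (g.indexEquiv t) v,
      h = (p v).hom ≫ g₂} := by
    rw [g.compat t v]
    exact ⟨f, hf, ψ, hψ, rfl⟩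
  obtain ⟨p, hp, g₂, hg₂, heq⟩ := hmem
  have h1 : K.labOfHom v (f ≫ (K.atV v).map ψ.hom) = K.gLabMap ψ ∘ ζ₁ := by
    rw [K.labOfHom_post, hζ₁.1 f hf]
  have h2 : K.labOfHom v ((p v).hom ≫ g₂) = ζ₂ ∘ K.labMap v (φ v) := by
    rw [K.labOfHom_pre, hζ₂.1 g₂ hg₂]
    rw [hφ] at hp
    rw [(DStrip.mem_plusFullPolyIso_iff.mp hp) v]
  rw [heq] at h1
  ext x
  exact (congrFun (h2.symm.trans h1) x).symm

/-! ### Proposition 6.6 (ii): injectivity -/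

/-- **[IUTchI] Prop 6.6 (ii), injectivity half — PROVED** (for base kits with a valuation): an isomorphism
of `𝒟-Θ^{ell}`-bridges is determined by its induced isomorphism of `𝔽_l^±`-torsors between the index sets
("maps bijectively, by considering the induced bijections …", p. 165 — the injectivity).
[claim: Mochizuki2012, status: disputed] -/
theorem Iso.eq_of_indexEquiv_eq (hV : Nonempty K.V) {B₁ B₂ : K.DThetaEllBridge} (g g' : Iso B₁ B₂)
    (h : g.indexEquiv = g'.indexEquiv) : g = g' := by
  obtain ⟨v₀⟩ := hV
  -- the `ζ`'s of both bridges (Prop 6.5 (i))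
  have hZ₁ := B₁.inducesZeta
  have hZ₂ := B₂.inducesZeta
  -- destructure; the index bijections agree
  rcases g with ⟨κ, hκ, cp, hcp, Q, hQ, hc⟩
  rcases g' with ⟨κ', hκ', cp', hcp', Q', hQ', hc'⟩
  dsimp only at h
  subst h
  obtain ⟨ψ, hQψ⟩ := hQ
  obtain ⟨ψ', hQψ'⟩ := hQ'
  have hcp₀ := hcp
  have hcp₀' := hcp'
  choose φ hφ using hcp₀
  choose φ' hφ' using hcp₀'
  have hψ : ψ ∈ Q := by rw [hQψ]; exact ⟨1, one_mem _, (Iso.trans_refl _).symm⟩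
  have hψ' : ψ' ∈ Q' := by rw [hQψ']; exact ⟨1, one_mem _, (Iso.trans_refl _).symm⟩
  -- the relative sign at `(t, v)` is `‡ζ`-conjugate to the FIXED element `D := gLabMap(ψ⁻¹ ∘ ψ')`
  have key : ∀ t v (ζ₂ : K.LabCuspPM v ((B₂.capsule (κ t)).obj v) ≃ K.GLab B₂.glob),
      B₂.ZetaSpec (κ t) v ζ₂ →
      (K.labMap v (φ t v)).symm.trans (K.labMap v (φ' t v)) =
        ζ₂.trans (((K.gLabMap ψ).symm.trans (K.gLabMap ψ')).trans ζ₂.symm) := by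
    intro t v ζ₂ hζ₂
    obtain ⟨ζ₁, hζ₁⟩ := hZ₁ t v
    have e1 := Iso.zeta_trans_gLabMap ⟨κ, hκ, cp, fun t => ⟨φ t, hφ t⟩, Q, ⟨ψ, hQψ⟩, hc⟩ t v (hφ t) hψ hζ₁ hζ₂
    have e2 := Iso.zeta_trans_gLabMap ⟨κ, hκ', cp', fun t => ⟨φ' t, hφ' t⟩, Q', ⟨ψ', hQψ'⟩, hc'⟩ t v (hφ' t) hψ' hζ₁ hζ₂
    dsimp only at e1 e2
    -- `labMap φ = ζ₁ ψ ζ₂⁻¹`, `labMap φ' = ζ₁ ψ' ζ₂⁻¹`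
    have f1 : K.labMap v (φ t v) = ζ₁.trans ((K.gLabMap ψ).trans ζ₂.symm) := by
      rw [← Equiv.trans_assoc, e1, Equiv.trans_assoc, Equiv.self_trans_symm, Equiv.trans_refl]
    have f2 : K.labMap v (φ' t v) = ζ₁.trans ((K.gLabMap ψ').trans ζ₂.symm) := by
      rw [← Equiv.trans_assoc, e2, Equiv.trans_assoc, Equiv.self_trans_symm, Equiv.trans_refl]
    rw [f1, f2]
    ext x
    simp
  -- dichotomy at `v₀`
  by_cases hA : ∃ t, (K.labMap v₀ (φ t v₀)).symm.trans (K.labMap v₀ (φ' t v₀)) = Equiv.refl _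
  · -- Case A: `D` is trivial, hence all relative signs are `+`, and `ψ' ∈ ψ · Aut_csp`
    obtain ⟨t₀, ht₀⟩ := hA
    obtain ⟨ζ₂, hζ₂⟩ := hZ₂ (κ t₀) v₀
    have hD : (K.gLabMap ψ).symm.trans (K.gLabMap ψ') = Equiv.refl _ := by
      have h1 := key t₀ v₀ ζ₂ hζ₂
      rw [ht₀] at h1
      ext q
      have h2 := congrArg (fun E => ζ₂ (E (ζ₂.symm q))) h1
      simpa using h2.symm
    -- capsule constituents agree
    have hcp_eq : cp = cp' := by
      funext t
      rw [show cp t = DStrip.plusFullPolyIso (φ t) from hφ t,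
        show cp' t = DStrip.plusFullPolyIso (φ' t) from hφ' t, DStrip.plusFullPolyIso_eq_iff]
      intro v
      obtain ⟨ζ₂', hζ₂'⟩ := hZ₂ (κ t) v
      have h1 := key t v ζ₂' hζ₂'
      rw [hD] at h1
      have h3 : (K.labMap v (φ t v)).symm.trans (K.labMap v (φ' t v)) = Equiv.refl _ := by
        rw [h1]; ext x; simp
      rw [← labMap_symm, ← K.labMap_trans, labMap_symm_trans_eq_refl_iff] at h3
      exact h3
    -- global constituents agree
    have hcsp : ψ.symm ≪≫ ψ' ∈ K.autCsp B₂.glob := by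
      show K.gLabMap (ψ.symm ≪≫ ψ') = Equiv.refl _
      rw [K.gLabMap_trans, gLabMap_symm, hD]
    have hQ_eq : Q = Q' := by
      rw [hQψ, hQψ']
      ext χ
      constructor
      · rintro ⟨c, hc, rfl⟩
        refine ⟨(ψ.symm ≪≫ ψ').symm ≪≫ c, (K.autCsp B₂.glob).mul_mem hc ?_, by simp⟩
        have := (K.autCsp B₂.glob).inv_mem hcsp
        rwa [Aut.Aut_inv_def] at this
      · rintro ⟨c, hc, rfl⟩
        refine ⟨(ψ.symm ≪≫ ψ') ≪≫ c, (K.autCsp B₂.glob).mul_mem hc hcsp, by simp⟩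
    subst hcp_eq
    subst hQ_eq
    rfl
  · -- Case B: every relative sign at `v₀` is `−`; then `D` is a reflection about every label: absurd
    exfalso
    simp only [not_exists] at hA
    have hB : ∀ t, (K.labMap v₀ (φ t v₀)).symm.trans (K.labMap v₀ (φ' t v₀)) =
        labNeg ((B₂.capsule (κ t)).isLocal v₀) := by
      intro t
      rw [← labMap_symm, ← K.labMap_trans]
      exact (labMap_ne_refl_iff _ _).mp (by rw [K.labMap_trans, labMap_symm]; exact hA t)
    -- coordinates of `B₂` and the `‡ζ`'s in closed form
    obtain ⟨ι₂, hι₂, α₂, γ₂, hE₂⟩ := B₂.exists_model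
    let αT : ∀ s : B₂.T, (DStrip.model K).Iso (B₂.capsule s) := fun s w =>
      α₂ (ι₂.symm s) w ≪≫ eqToIso (congrArg (fun r => (B₂.capsule r).obj w) (ι₂.apply_symm_apply s))
    have hαT : ∀ z, αT (ι₂ z) = α₂ z := fun z =>
      DStrip.isoCast_eq (fun r => B₂.capsule (ι₂ r)) _ α₂ (ι₂.symm_apply_apply z)
    have hζform : ∀ t : B₁.T,
        B₂.ZetaSpec (κ t) v₀ (zetaCandidate v₀ (αT (κ t) v₀) γ₂ (ι₂.symm (κ t))) := by
      intro t
      obtain ⟨ζ, hζ⟩ := hZ₂ (κ t) v₀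
      have hgen : ∀ (s : B₂.T) (ζ : K.LabCuspPM v₀ ((B₂.capsule s).obj v₀) ≃ K.GLab B₂.glob),
          B₂.ZetaSpec s v₀ ζ → ζ = zetaCandidate v₀ (αT s v₀) γ₂ (ι₂.symm s) := by
        intro s ζ hζ
        obtain ⟨z, rfl⟩ := ι₂.surjective s
        rw [hαT, Equiv.symm_apply_apply]
        exact B₂.zeta_eq_zetaCandidate (ι := ι₂) (α := α₂) (β := γ₂) hE₂ z v₀ hζ
      rw [← hgen _ ζ hζ]
      exact hζ
    -- notation
    let S : FlPMGroup l (K.LabCuspPM v₀ (K.model v₀)) := K.labPM v₀ (K.model v₀) ⟨Iso.refl _⟩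
    obtain ⟨L, hL⟩ : ∃ L : K.LabCuspPM v₀ (K.model v₀) ≃ K.GLab K.gModel,
        Equiv.ofBijective _ (K.labOfHom_phiEll_bijective v₀) = L := ⟨_, rfl⟩
    obtain ⟨n, hn⟩ : ∃ n : Equiv.Perm (K.LabCuspPM v₀ (K.model v₀)), labNeg (K.isLocal_model v₀) = n :=
      ⟨_, rfl⟩
    obtain ⟨D, hDdef⟩ : ∃ D : K.GLab B₂.glob ≃ K.GLab B₂.glob,
        (K.gLabMap ψ).symm.trans (K.gLabMap ψ') = D := ⟨_, rfl⟩
    let w : B₁.T → ZMod l := fun t => ι₂.symm (κ t)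
    -- (★) `D` moves the point `γ₂ (T_{w t} q)` to `γ₂ (T_{w t} (L n L⁻¹ q))`, for EVERY `t`
    have hstar : ∀ (t : B₁.T) (q : K.GLab K.gModel),
        D (K.gLabMap γ₂ (gTransl K (w t) q)) = K.gLabMap γ₂ (gTransl K (w t) (L (n (L.symm q)))) := by
      intro t q
      have h1 := key t v₀ _ (hζform t)
      rw [hB t, hDdef] at h1
      have hconj := labMap_conj_labNeg ((B₂.capsule (κ t)).isLocal v₀) (K.isLocal_model v₀) (αT (κ t) v₀).symm
      rw [hn] at hconj
      -- evaluate `h1` at `x := LabCusp^±(α)(L⁻¹ q)`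
      have h1x := congrArg (fun E => zetaCandidate v₀ (αT (κ t) v₀) γ₂ (ι₂.symm (κ t))
        (E ((K.labMap v₀ (αT (κ t) v₀).symm).symm (L.symm q)))) h1
      have hnx : K.labMap v₀ (αT (κ t) v₀).symm (labNeg ((B₂.capsule (κ t)).isLocal v₀)
          ((K.labMap v₀ (αT (κ t) v₀).symm).symm (L.symm q))) = n (L.symm q) := by
        have := congrArg (fun E => E (L.symm q)) hconj
        simpa using this
      simp only [zetaCandidate, hL, Equiv.trans_apply, Equiv.apply_symm_apply, hnx] at h1x
      exact h1x.symm
    -- the torsor chart `S.chart₀ ∘ L⁻¹ = h • gChart₀` and the involution `n`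
    obtain ⟨h, hh⟩ := K.gLabT.exists_of_mem K.gChart₀_mem (K.labOfHom_phiEll_charts v₀ _ S.chart₀_mem)
    rw [hL] at hh
    have hhq : ∀ q, S.chart₀ (L.symm q) = h • K.gChart₀ q := fun q => by
      have := congrArg (fun E => E q) hh
      simpa using this
    have hnm : ∀ m, S.chart₀ (n m) = -S.chart₀ m := fun m => by simp [← hn, labNeg, S, Units.smul_def]
    have hT : ∀ (c : ZMod l) (q : K.GLab K.gModel), K.gChart₀ (gTransl K c q) = K.gChart₀ q + c :=
      fun c q => by simp [gTransl]
    -- (i') `h • gChart₀ (ρ q) = −(h • gChart₀ q)` for `ρ := L n L⁻¹`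
    have hρ : ∀ q, h • K.gChart₀ (L (n (L.symm q))) = -(h • K.gChart₀ q) := fun q => by
      rw [← hhq, ← hhq, Equiv.symm_apply_apply, hnm]
    -- two indices whose labels differ by `1`
    let t₁ : B₁.T := κ.symm (ι₂ 0)
    let t₂ : B₁.T := κ.symm (ι₂ (w t₁ + 1))
    have hw₂ : w t₂ = w t₁ + 1 := by simp [w, t₂]
    -- (ii') `gChart₀ (ρ q) = gChart₀ (ρ (T_{−1} q)) + 1`
    have hii : ∀ q, K.gChart₀ (L (n (L.symm q))) = K.gChart₀ (L (n (L.symm (gTransl K (-1) q)))) + 1 := by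
      intro q
      have hq : gTransl K (w t₂) (gTransl K (-1) q) = gTransl K (w t₁) q := by
        apply K.gChart₀.injective
        rw [hT, hT, hT, hw₂]
        ring
      have e1 := hstar t₁ q
      have e2 := hstar t₂ (gTransl K (-1) q)
      rw [hq, e1] at e2
      have e3 := congrArg K.gChart₀ ((K.gLabMap γ₂).injective e2)
      rw [hT, hT, hw₂] at e3
      linear_combination e3
    -- the algebra: `2 = 0` in `𝔽_l`
    have hq0 := hρ (K.gChart₀.symm 0)
    have hq1 := hρ (gTransl K (-1) (K.gChart₀.symm 0))
    have hst := hii (K.gChart₀.symm 0)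
    rw [hT] at hq1
    simp only [FlPM.smul_def, Units.smul_def, zsmul_eq_mul, Equiv.apply_symm_apply, mul_zero, zero_add] at hq0 hq1 hst
    have hε : ((h.right : ℤ) : ZMod l) * ((h.right : ℤ) : ZMod l) = 1 := by
      rcases Int.units_eq_one_or h.right with hr | hr <;> simp [hr]
    have h2ε : (2 : ZMod l) * ((h.right : ℤ) : ZMod l) = 0 := by
      linear_combination hq0 - hq1 - ((h.right : ℤ) : ZMod l) * hst
    exact two_ne_zero_of_isLocal (K.isLocal_model v₀) (by linear_combination ((h.right : ℤ) : ZMod l) * h2ε - 2 * hε)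

/-- **[IUTchI] Prop 6.6 (ii), injectivity half — PROVED** in the form of the named statement: the map
from isomorphisms of `𝒟-Θ^{ell}`-bridges to isomorphisms of `𝔽_l^±`-torsors between the index sets
(second conjunct of `DThetaEllBridge.IsoTorsor`) is INJECTIVE, for base kits with a valuation.
[claim: Mochizuki2012, status: disputed] -/
theorem isoTorsor_injective (hV : Nonempty K.V) (B₁ B₂ : K.DThetaEllBridge) :
    Function.Injective fun g : Iso B₁ B₂ =>
      (⟨g.indexEquiv, g.indexEquiv_charts⟩ : {ι : B₁.T ≃ B₂.T // B₁.torT.Compat B₂.torT ι}) :=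
  fun g g' h => Iso.eq_of_indexEquiv_eq hV g g' (congrArg Subtype.val h)

end DThetaEllBridge

/-! ### Proposition 6.6 (iii): injectivity -/

namespace DStrip

/-- Left cancellation for `+`-full poly-isomorphisms: `θ · ψ · Aut_+ = θ · ψ' · Aut_+` implies
`ψ · Aut_+ = ψ' · Aut_+`. [claim: Mochizuki2012, status: disputed] -/
theorem plusFullPolyIso_trans_left_cancel {D₁ D₂ D₃ : K.DStrip} (θ : D₁.Iso D₂) {ψ ψ' : D₂.Iso D₃}
    (h : DStrip.plusFullPolyIso (θ.trans ψ) = DStrip.plusFullPolyIso (θ.trans ψ')) :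
    DStrip.plusFullPolyIso ψ = DStrip.plusFullPolyIso ψ' := by
  rw [plusFullPolyIso_eq_iff] at h ⊢
  intro v
  have hv := h v
  change K.labMap v (θ v ≪≫ ψ v) = K.labMap v (θ v ≪≫ ψ' v) at hv
  rw [K.labMap_trans, K.labMap_trans] at hv
  ext x
  simpa using congrArg (fun e => e ((K.labMap v (θ v)).symm x)) hv

end DStrip

namespace DThetaPMEllHT

/-- **[IUTchI] Prop 6.6 (iii), injectivity half — PROVED**: an isomorphism of `𝒟-Θ^{±ell}`-Hodge theaters
is determined by its induced isomorphism of `𝔽_l^±`-groups between the index sets (the map in the second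
conjunct of `DThetaPMEllHT.IsoTorsor` is injective), for base kits with a valuation: the `Θ^{ell}`-part is
rigid (Prop 6.6 (ii)), the two parts share their capsule poly-isomorphism, and the `Θ^±`-part is then
forced ([IUTchI] Prop 6.6 (iii) p. 165). [claim: Mochizuki2012, status: disputed] -/
theorem isoTorsor_injective (hV : Nonempty K.V) (H₁ H₂ : K.DThetaPMEllHT) :
    Function.Injective fun g : Iso H₁ H₂ =>
      (⟨g.pmIso.indexEquiv, g.pmIso.indexEquiv_charts⟩ : {ι : H₁.T ≃ H₂.T // H₁.grpT.Compat H₂.grpT ι}) := by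
  intro g g' h
  have hκ : g.pmIso.indexEquiv = g'.pmIso.indexEquiv := congrArg Subtype.val h
  rcases g with ⟨pm, ell, hidx, hcaps⟩
  rcases g' with ⟨pm', ell', hidx', hcaps'⟩
  dsimp only at hκ hidx hidx' hcaps hcaps' ⊢
  -- the `Θ^{ell}`-parts agree (Prop 6.6 (ii), injectivity)
  have hell : ell = ell' := by
    apply DThetaEllBridge.Iso.eq_of_indexEquiv_eq hV
    ext t
    rw [← hidx t, ← hidx' t, hκ]
  subst hell
  -- the `Θ^±`-parts: same index bijection, same capsule poly-isomorphism, hence same `+`-full `†𝔇_≻ ⥲ ‡𝔇_≻`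
  rcases pm with ⟨κ, hκc, cp, hcp, cod, hcod, hc⟩
  rcases pm' with ⟨κ', hκc', cp', hcp', cod', hcod', hc'⟩
  dsimp only at hκ hidx hidx' hcaps hcaps' hc hc' ⊢
  subst hκ
  have hcp_eq : cp = cp' := by
    funext t
    ext p
    exact (hcaps t p).trans (hcaps' t p).symm
  subst hcp_eq
  have hcod_eq : cod = cod' := by
    obtain ⟨θ₁, hθ₁⟩ := H₁.pmBridge.exists_poly_eq
    obtain ⟨ι₁, -⟩ := H₁.exists_model
    obtain ⟨ψ, hψ⟩ := hcod
    obtain ⟨ψ', hψ'⟩ := hcod'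
    change cod = DStrip.plusFullPolyIso ψ at hψ
    change cod' = DStrip.plusFullPolyIso ψ' at hψ'
    have e := (hc (ι₁ 0)).symm.trans (hc' (ι₁ 0))
    rw [hψ, hψ', hθ₁, DStrip.polyComp_plusFullPolyIso, DStrip.polyComp_plusFullPolyIso] at e
    rw [hψ, hψ']
    exact DStrip.plusFullPolyIso_trans_left_cancel _ e
  subst hcod_eq
  rfl

end DThetaPMEllHT

end PMBaseKit

end Literature.IUT.HodgeTheaters
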